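import Literature.Topology.FourManifolds.ClosedBallExtension
import Literature.Topology.FourManifolds.ClosedBallSmoothEmbeddings
import Literature.Topology.FourManifolds.ImmersionOrientation
import Literature.Topology.FourManifolds.SmoothEmbeddingComp
import Literature.Topology.FourManifolds.HandleAttachingMapsInversion
import HarnessLib

/-!
# The pushed prefix sub-handlebody, I: immersions of the closed ball are locally restrictions of
# ambient immersions
(tool file 1/3 of brick (ii-2) "the global pushed embedding `jX₁' : X₁ → M'`" of the sub-goal T3b
of stub `stub_steinRealisation` (NF6), line `modp-braid-orbits` r11, crux
`ConvexBisection.AcyclicBisectionExists`, item stmt-SmoothPoincare4-10508; wave 4, lead c5,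
worker Y5)

The global push of the prefix sub-handlebody `X₁` (files 2/3, 3/3) is, on Kosinski's tube
`T ⊆ D⁴` of an attaching circle, a composite `Ĵ ∘ S` of an ABSTRACT smooth embedding
`Ĵ : T → M'` of the manifold with boundary `T` (the attaching map followed by the gluing embedding)
with an EXPLICIT local diffeomorphism `S` of `ℝ⁴` (Z3's `selfPush`) which pushes part of the
boundary sphere into the interior.  To see that `Ĵ ∘ S` is again an immersion of the manifold with
boundary (Mathlib's chart sense `Manifold.IsImmersionAt (𝓡∂ 4) (𝓡 4)`), boundary points included,
one needs `Ĵ` as the restriction of a smooth map of an OPEN neighbourhood in `ℝ⁴`.  This file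
provides exactly that, in all dimensions:

* `exists_contMDiff_eventuallyEq_closedBall` — a map on `𝔻ⁿ⁺¹` which is `C^∞` on an open
  neighbourhood of `u` agrees near `u` with a globally `C^∞` map (ambient bump function);
* **`exists_ambient_of_isImmersionAt_closedBall`** — if `Ĵ : 𝔻ⁿ⁺¹ → N` (`N` without boundary,
  modelled on `ℝᵐ`) is an immersion at `u` (interior or boundary point), there are an open
  `O ∋ u` of `ℝⁿ⁺¹` and `g : ℝⁿ⁺¹ → N`, `C^∞` on `O`, with `g = Ĵ` on `O ∩ 𝔻ⁿ⁺¹` and `g` an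
  immersion at `u` (read `Ĵ` in an immersion chart `ψ` of `N`, cut off, extend across the sphere by
  Seeley's theorem `exists_contDiff_extension_of_contMDiff_closedBall`, pull back by `ψ⁻¹`; the
  differential stays injective because that of the inclusion `𝔻ⁿ⁺¹ ↪ ℝⁿ⁺¹` is an isomorphism,
  `hasMFDerivAt_coe_closedBall`, and the immersion criterion `isImmersionAt_of_injective_mfderiv`);
* **`isImmersionAt_closedBall_of_eventuallyEq_comp`** — hence `K : 𝔻ⁿ⁺¹ → N` is an immersion at
  `y` as soon as `K = Ĵ ∘ Φ` near `y` for a partial diffeomorphism `Φ` of `ℝⁿ⁺¹` with `Φ y ∈ 𝔻ⁿ⁺¹`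
  and `Ĵ` an immersion at `Φ y` (`comp_openPartialHomeomorph`, then
  `isImmersionAtOfComplement_comp_coe_closedBall`);
* `isImmersionAt_opens_extend` — passing between an open piece `U ⊆ 𝔻ⁿ⁺¹` and `𝔻ⁿ⁺¹`;
* `helper_isImmersionAt_closedBall_comp` (registered) — the tool in tree vocabulary.

Everything here is proved; no named facts, no definitions.

## References
* J. M. Lee, *Introduction to Smooth Manifolds* (2013), Thm. 4.15 (local immersion theorem for
  manifolds with boundary), Lemma 2.26. [LeeSmoothManifolds2013]
* R. T. Seeley, *Extension of `C^∞` functions defined in a half space*, PAMS 15 (1964). [Seeley1964]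
-/

noncomputable section

-- the prescribed namespace `Summit.<P>.<Sub>.…` duplicates `SmoothPoincare4` (P = Sub)
set_option linter.dupNamespace false

open scoped Manifold ContDiff Topology

namespace Summit.SmoothPoincare4.SmoothPoincare4.Theorems.AcyclicBisectionExists.ModpBraidOrbits

open Set Function Metric Filter
open Literature.Topology.FourManifolds

section Ambient

variable {n m : ℕ} {N : Type*} [TopologicalSpace N] [ChartedSpace (EuclideanSpace ℝ (Fin m)) N]
  [IsManifold (𝓡 m) ∞ N]

/-- **Cutting off**: a map on `𝔻ⁿ⁺¹` with values in a normed space which is `C^∞` on an open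
neighbourhood `U` of `u` agrees near `u` with a globally `C^∞` map (multiply by an ambient bump
function centred at `u` with support inside `U`). [cite: LeeSmoothManifolds2013, Lemma 2.26] -/
theorem exists_contMDiff_eventuallyEq_closedBall {F : Type*} [NormedAddCommGroup F] [NormedSpace ℝ F]
    {T : Metric.closedBall (0 : EuclideanSpace ℝ (Fin (n + 1))) 1 → F}
    {U : Set (Metric.closedBall (0 : EuclideanSpace ℝ (Fin (n + 1))) 1)} (hU : IsOpen U)
    {u : Metric.closedBall (0 : EuclideanSpace ℝ (Fin (n + 1))) 1} (hu : u ∈ U)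
    (hT : ContMDiffOn (𝓡∂ (n + 1)) 𝓘(ℝ, F) ∞ T U) :
    ∃ G : Metric.closedBall (0 : EuclideanSpace ℝ (Fin (n + 1))) 1 → F,
      ContMDiff (𝓡∂ (n + 1)) 𝓘(ℝ, F) ∞ G ∧ G =ᶠ[𝓝 u] T := by
  obtain ⟨r, hr, hrU⟩ := Metric.isOpen_iff.1 hU u hu
  let χ : ContDiffBump (u : EuclideanSpace ℝ (Fin (n + 1))) := ⟨r / 4, r / 2, by positivity, by linarith⟩
  have hχ : ContMDiff (𝓡∂ (n + 1)) 𝓘(ℝ, ℝ) ∞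
      fun z : Metric.closedBall (0 : EuclideanSpace ℝ (Fin (n + 1))) 1 => χ z :=
    χ.contDiff.contMDiff.comp contMDiff_coe_closedBall
  refine ⟨fun z => χ z • T z, fun z => ?_, ?_⟩
  · by_cases hz : dist z u < r
    · have hzU : U ∈ 𝓝 z := hU.mem_nhds (hrU (mem_ball.2 hz))
      exact (hχ z).smul (hT.contMDiffAt hzU)
    · have hev : (fun w : Metric.closedBall (0 : EuclideanSpace ℝ (Fin (n + 1))) 1 => χ w • T w) =ᶠ[𝓝 z]
          fun _ => 0 := by
        have ho : IsOpen {w : Metric.closedBall (0 : EuclideanSpace ℝ (Fin (n + 1))) 1 | r / 2 < dist w u} :=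
          isOpen_lt continuous_const (continuous_id.dist continuous_const)
        filter_upwards [ho.mem_nhds (show r / 2 < dist z u by linarith [not_lt.1 hz])] with w hw
        have : χ w = 0 := χ.zero_of_le_dist (by
          show r / 2 ≤ dist (w : EuclideanSpace ℝ (Fin (n + 1))) u
          exact le_of_lt hw)
        rw [this, zero_smul]
      exact contMDiffAt_const.congr_of_eventuallyEq hev
  · have ho : IsOpen {w : Metric.closedBall (0 : EuclideanSpace ℝ (Fin (n + 1))) 1 | dist w u < r / 4} :=
      isOpen_lt (continuous_id.dist continuous_const) continuous_const
    filter_upwards [ho.mem_nhds (show dist u u < r / 4 by rw [dist_self]; positivity)] with w hw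
    have : χ w = 1 := χ.one_of_mem_closedBall (by
      show dist (w : EuclideanSpace ℝ (Fin (n + 1))) u ≤ r / 4
      exact le_of_lt hw)
    rw [this, one_smul]

/-- **Immersions of the closed ball are locally restrictions of ambient immersions.**  If
`Ĵ : 𝔻ⁿ⁺¹ → N` (`N` without boundary, modelled on `ℝᵐ`) is a `C^∞` immersion at `u ∈ 𝔻ⁿ⁺¹`
(interior or boundary point, Mathlib's chart sense for the model with boundary `𝓡∂ (n + 1)`),
then there are an open neighbourhood `O` of `u` in `ℝⁿ⁺¹` and `g : ℝⁿ⁺¹ → N`, `C^∞` on `O`, with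
`g = Ĵ` on `O ∩ 𝔻ⁿ⁺¹`, which is an immersion at `u` as a map of `ℝⁿ⁺¹`.  (Read `Ĵ` in its
immersion chart `ψ`, cut off, extend by Seeley's theorem, pull back by `ψ⁻¹`; the differential of
`g` at `u` is injective because `mfderiv Ĵ u = mfderiv g u ∘ closedBallCoeDeriv u`.)
[cite: LeeSmoothManifolds2013, Thm. 4.15 (proof)] -/
theorem exists_ambient_of_isImmersionAt_closedBall
    {J : Metric.closedBall (0 : EuclideanSpace ℝ (Fin (n + 1))) 1 → N}
    {u : Metric.closedBall (0 : EuclideanSpace ℝ (Fin (n + 1))) 1}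
    (h : Manifold.IsImmersionAt (𝓡∂ (n + 1)) (𝓡 m) ∞ J u) :
    ∃ (O : Set (EuclideanSpace ℝ (Fin (n + 1)))) (g : EuclideanSpace ℝ (Fin (n + 1)) → N),
      IsOpen O ∧ (u : EuclideanSpace ℝ (Fin (n + 1))) ∈ O ∧
      ContMDiffOn 𝓘(ℝ, EuclideanSpace ℝ (Fin (n + 1))) (𝓡 m) ∞ g O ∧
      (∀ (y : EuclideanSpace ℝ (Fin (n + 1))) (hy : y ∈ Metric.closedBall (0 : EuclideanSpace ℝ (Fin (n + 1))) 1),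
        y ∈ O → g y = J ⟨y, hy⟩) ∧
      Manifold.IsImmersionAt 𝓘(ℝ, EuclideanSpace ℝ (Fin (n + 1))) (𝓡 m) ∞ g u := by
  haveI : CompleteSpace (EuclideanSpace ℝ (Fin m)) := FiniteDimensional.complete ℝ _
  set e := h.domChart with he_def
  set ψ := h.codChart with hψ_def
  have hψ : ψ ∈ IsManifold.maximalAtlas (𝓡 m) ∞ N := h.codChart_mem_maximalAtlas
  have hue : u ∈ e.source := h.mem_domChart_source
  have hsrc : e.source ⊆ J ⁻¹' ψ.source := h.source_subset_preimage_source
  have hJ : ContMDiffOn (𝓡∂ (n + 1)) (𝓡 m) ∞ J e.source := h.contMDiffOn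
  -- `ψ ∘ J`, cut off and extended
  have hT : ContMDiffOn (𝓡∂ (n + 1)) 𝓘(ℝ, EuclideanSpace ℝ (Fin m)) ∞ (fun z => ψ (J z)) e.source :=
    (contMDiffOn_of_mem_maximalAtlas hψ).comp hJ hsrc
  obtain ⟨G, hG, hGT⟩ := exists_contMDiff_eventuallyEq_closedBall e.open_source hue hT
  obtain ⟨g₁, hg₁, hg₁G⟩ := exists_contDiff_extension_of_contMDiff_closedBall G hG
  -- the neighbourhood where everything agrees
  have hev : {z | G z = ψ (J z) ∧ z ∈ e.source} ∈ 𝓝 u := inter_mem hGT (e.open_source.mem_nhds hue)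
  obtain ⟨t, ht, htsub⟩ := (mem_nhds_subtype _ u _).1 hev
  obtain ⟨O₀, hO₀t, hO₀, huO₀⟩ := _root_.mem_nhds_iff.1 ht
  set O : Set (EuclideanSpace ℝ (Fin (n + 1))) := O₀ ∩ g₁ ⁻¹' ψ.target with hO_def
  have hO : IsOpen O := hO₀.inter (ψ.open_target.preimage hg₁.continuous)
  have hGu : G u = ψ (J u) := hGT.eq_of_nhds
  have huO : (u : EuclideanSpace ℝ (Fin (n + 1))) ∈ O := by
    refine ⟨huO₀, ?_⟩
    show g₁ u ∈ ψ.target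
    rw [hg₁G u, hGu]
    exact ψ.map_source (hsrc hue)
  have hagree : ∀ (y : EuclideanSpace ℝ (Fin (n + 1))) (hy : y ∈ Metric.closedBall (0 : EuclideanSpace ℝ (Fin (n + 1))) 1),
      y ∈ O → ψ.symm (g₁ y) = J ⟨y, hy⟩ ∧ (⟨y, hy⟩ : Metric.closedBall (0 : EuclideanSpace ℝ (Fin (n + 1))) 1) ∈ e.source := by
    intro y hy hyO
    have hz := htsub (show (⟨y, hy⟩ : Metric.closedBall (0 : EuclideanSpace ℝ (Fin (n + 1))) 1) ∈ Subtype.val ⁻¹' t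
      from hO₀t hyO.1)
    refine ⟨?_, hz.2⟩
    rw [hg₁G ⟨y, hy⟩, hz.1]
    exact ψ.left_inv (hsrc hz.2)
  have hg : ContMDiffOn 𝓘(ℝ, EuclideanSpace ℝ (Fin (n + 1))) (𝓡 m) ∞ (fun y => ψ.symm (g₁ y)) O :=
    (contMDiffOn_symm_of_mem_maximalAtlas hψ).comp hg₁.contMDiff.contMDiffOn fun y hy => hy.2
  refine ⟨O, fun y => ψ.symm (g₁ y), hO, huO, hg, fun y hy hyO => (hagree y hy hyO).1, ?_⟩
  -- injectivity of the differential at `u`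
  have hgu : ContMDiffAt 𝓘(ℝ, EuclideanSpace ℝ (Fin (n + 1))) (𝓡 m) ∞ (fun y => ψ.symm (g₁ y)) u :=
    hg.contMDiffAt (hO.mem_nhds huO)
  have h1 : Injective (mfderiv (𝓡∂ (n + 1)) (𝓡 m) J u) := injective_mfderiv_of_isImmersionAt' h
  have h2 : ((fun y => ψ.symm (g₁ y)) ∘ Subtype.val :
      Metric.closedBall (0 : EuclideanSpace ℝ (Fin (n + 1))) 1 → N) =ᶠ[𝓝 u] J := by
    filter_upwards [continuous_subtype_val.continuousAt.preimage_mem_nhds (hO.mem_nhds huO)] with z hz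
    exact (hagree z z.2 hz).1
  have h3 : HasMFDerivAt (𝓡∂ (n + 1)) (𝓡 m)
      ((fun y => ψ.symm (g₁ y)) ∘ Subtype.val : Metric.closedBall (0 : EuclideanSpace ℝ (Fin (n + 1))) 1 → N) u
      ((mfderiv 𝓘(ℝ, EuclideanSpace ℝ (Fin (n + 1))) (𝓡 m) (fun y => ψ.symm (g₁ y)) u).comp
        (closedBallCoeDeriv u : EuclideanSpace ℝ (Fin (n + 1)) →L[ℝ] EuclideanSpace ℝ (Fin (n + 1)))) :=
    (hgu.mdifferentiableAt (by simp)).hasMFDerivAt.comp u (hasMFDerivAt_coe_closedBall u)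
  rw [← h2.mfderiv_eq, h3.mfderiv] at h1
  have h4 : Injective ((mfderiv 𝓘(ℝ, EuclideanSpace ℝ (Fin (n + 1))) (𝓡 m) (fun y => ψ.symm (g₁ y)) u) ∘
      (closedBallCoeDeriv u)) := h1
  exact isImmersionAt_of_injective_mfderiv hO huO hg (by exact_mod_cast le_top)
    (h4.of_comp_right (closedBallCoeDeriv u).surjective)

/-- **A composite `Ĵ ∘ Φ|𝔻ⁿ⁺¹` is an immersion of the closed ball.**  Let `Φ` be a partial
diffeomorphism of `ℝⁿ⁺¹` (`C^∞` with `C^∞` inverse) with `y ∈ Φ.source`, `Φ y ∈ 𝔻ⁿ⁺¹`, let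
`Ĵ : 𝔻ⁿ⁺¹ → N` be an immersion at `Φ y`, and let `K : 𝔻ⁿ⁺¹ → N` agree with `Ĵ ∘ Φ` near `y`
(wherever `Φ` lands in the ball).  Then `K` is an immersion at `y` for the model with boundary —
also when `y` or `Φ y` is a boundary point and `Φ` does not preserve the ball.
[cite: LeeSmoothManifolds2013, Thm. 4.15] -/
theorem isImmersionAt_closedBall_of_eventuallyEq_comp
    {J K : Metric.closedBall (0 : EuclideanSpace ℝ (Fin (n + 1))) 1 → N}
    (Φ : OpenPartialHomeomorph (EuclideanSpace ℝ (Fin (n + 1))) (EuclideanSpace ℝ (Fin (n + 1))))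
    (hΦ : ContDiffOn ℝ ∞ Φ Φ.source) (hΦ' : ContDiffOn ℝ ∞ Φ.symm Φ.target)
    {y : Metric.closedBall (0 : EuclideanSpace ℝ (Fin (n + 1))) 1} (hy : (y : EuclideanSpace ℝ (Fin (n + 1))) ∈ Φ.source)
    (hΦy : Φ y ∈ Metric.closedBall (0 : EuclideanSpace ℝ (Fin (n + 1))) 1)
    (h : Manifold.IsImmersionAt (𝓡∂ (n + 1)) (𝓡 m) ∞ J ⟨Φ y, hΦy⟩)
    (hK : ∀ᶠ z : Metric.closedBall (0 : EuclideanSpace ℝ (Fin (n + 1))) 1 in 𝓝 y,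
      ∀ hz : Φ (z : EuclideanSpace ℝ (Fin (n + 1))) ∈ Metric.closedBall (0 : EuclideanSpace ℝ (Fin (n + 1))) 1,
      K z = J ⟨Φ z, hz⟩)
    (hmaps : ∀ᶠ z : Metric.closedBall (0 : EuclideanSpace ℝ (Fin (n + 1))) 1 in 𝓝 y,
      Φ (z : EuclideanSpace ℝ (Fin (n + 1))) ∈ Metric.closedBall (0 : EuclideanSpace ℝ (Fin (n + 1))) 1) :
    Manifold.IsImmersionAt (𝓡∂ (n + 1)) (𝓡 m) ∞ K y := by
  obtain ⟨O, g, hO, hyO, hg, hgJ, hgi⟩ := exists_ambient_of_isImmersionAt_closedBall h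
  obtain ⟨F', _, _, hgi⟩ := hgi
  have h1 : Manifold.IsImmersionAtOfComplement F' 𝓘(ℝ, EuclideanSpace ℝ (Fin (n + 1))) (𝓡 m) ∞ (g ∘ Φ) y :=
    hgi.comp_openPartialHomeomorph Φ (contMDiffOn_iff_contDiffOn.2 hΦ) (contMDiffOn_iff_contDiffOn.2 hΦ') hy
  have h2 := isImmersionAtOfComplement_comp_coe_closedBall h1
  refine (h2.congr_of_eventuallyEq ?_).isImmersionAt
  have hO' : {z : Metric.closedBall (0 : EuclideanSpace ℝ (Fin (n + 1))) 1 | Φ (z : EuclideanSpace ℝ (Fin (n + 1))) ∈ O} ∈ 𝓝 y :=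
    ((Φ.continuousAt hy).comp continuous_subtype_val.continuousAt).preimage_mem_nhds (hO.mem_nhds hyO)
  filter_upwards [hK, hmaps, hO'] with z hz hzm hzO
  show g (Φ z) = K z
  rw [hgJ _ hzm hzO, hz hzm]

variable {M : Type*} [TopologicalSpace M] [ChartedSpace (EuclideanHalfSpace (n + 1)) M] [IsManifold (𝓡∂ (n + 1)) ∞ M]

omit [IsManifold (𝓡 m) ∞ N] in
open Classical in
/-- **From an open piece to the whole manifold**: if `f : U → N` (`U` open in `M`) is an
immersion at `x`, then the extension of `f` by a junk value is an immersion at `x` as a map on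
`M` (precompose with the inverse of the coercion chart `U ⇀ M`). [folklore] -/
theorem isImmersionAt_opens_extend (U : TopologicalSpace.Opens M) {f : U → N} {x : U} (q : N)
    (hf : Manifold.IsImmersionAt (𝓡∂ (n + 1)) (𝓡 m) ∞ f x) :
    Manifold.IsImmersionAt (𝓡∂ (n + 1)) (𝓡 m) ∞ (fun p : M => if hp : p ∈ U then f ⟨p, hp⟩ else q) x := by
  haveI hne : Nonempty U := ⟨x⟩
  obtain ⟨F', _, _, hf⟩ := hf
  set c := U.openPartialHomeomorphSubtypeCoe hne with hc
  have hΦ : ContMDiffOn (𝓡∂ (n + 1)) (𝓡∂ (n + 1)) ∞ c.symm c.symm.source :=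
    contMDiffOn_openPartialHomeomorphSubtypeCoe_symm U hne
  have hΦ' : ContMDiffOn (𝓡∂ (n + 1)) (𝓡∂ (n + 1)) ∞ c.symm.symm c.symm.target := by
    rw [OpenPartialHomeomorph.symm_symm, OpenPartialHomeomorph.symm_target]
    exact contMDiffOn_openPartialHomeomorphSubtypeCoe U hne
  have hsrc : (x : M) ∈ c.symm.source := by
    rw [OpenPartialHomeomorph.symm_source, TopologicalSpace.Opens.openPartialHomeomorphSubtypeCoe_target]
    exact x.2
  have hcx : c.symm (x : M) = x := by
    have := c.left_inv (show x ∈ c.source by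
      rw [TopologicalSpace.Opens.openPartialHomeomorphSubtypeCoe_source]; exact mem_univ _)
    rwa [TopologicalSpace.Opens.openPartialHomeomorphSubtypeCoe_coe] at this
  have h1 : Manifold.IsImmersionAtOfComplement F' (𝓡∂ (n + 1)) (𝓡 m) ∞ (f ∘ c.symm) (x : M) :=
    (hcx ▸ hf).comp_openPartialHomeomorph c.symm hΦ hΦ' hsrc
  refine (h1.congr_of_eventuallyEq ?_).isImmersionAt
  filter_upwards [U.isOpen.mem_nhds x.2] with p hp
  show f (c.symm p) = _
  rw [dif_pos (show p ∈ U from hp)]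
  congr 1
  have := c.left_inv (show (⟨p, hp⟩ : U) ∈ c.source by
    rw [TopologicalSpace.Opens.openPartialHomeomorphSubtypeCoe_source]; exact mem_univ _)
  rwa [TopologicalSpace.Opens.openPartialHomeomorphSubtypeCoe_coe] at this

end Ambient

/-- **Registered helper `helper_isImmersionAt_closedBall_comp` (tool for brick (ii-2) of T3b,
sub-goal of NF6 `stub_steinRealisation`, wave 4, lead c5): a map of the closed ball which near `y`
is an immersion `Ĵ` (possibly at a boundary point) precomposed with a partial diffeomorphism `Φ`
of the ambient `ℝⁿ⁺¹` is an immersion at `y` of the manifold with boundary `𝔻ⁿ⁺¹`.**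
[cite: LeeSmoothManifolds2013, Thm. 4.15] -/
theorem helper_isImmersionAt_closedBall_comp : ∀ {n m : ℕ} {N : Type*} [TopologicalSpace N] [ChartedSpace (EuclideanSpace ℝ (Fin m)) N] [IsManifold (𝓡 m) ∞ N] {J K : Metric.closedBall (0 : EuclideanSpace ℝ (Fin (n + 1))) 1 → N} (Φ : OpenPartialHomeomorph (EuclideanSpace ℝ (Fin (n + 1))) (EuclideanSpace ℝ (Fin (n + 1)))), ContDiffOn ℝ ∞ Φ Φ.source → ContDiffOn ℝ ∞ Φ.symm Φ.target → ∀ {y : Metric.closedBall (0 : EuclideanSpace ℝ (Fin (n + 1))) 1}, (y : EuclideanSpace ℝ (Fin (n + 1))) ∈ Φ.source → ∀ (hΦy : Φ y ∈ Metric.closedBall (0 : EuclideanSpace ℝ (Fin (n + 1))) 1), Manifold.IsImmersionAt (𝓡∂ (n + 1)) (𝓡 m) ∞ J ⟨Φ y, hΦy⟩ → Filter.Eventually (fun z : Metric.closedBall (0 : EuclideanSpace ℝ (Fin (n + 1))) 1 => ∀ hz : Φ (z : EuclideanSpace ℝ (Fin (n + 1))) ∈ Metric.closedBall (0 : EuclideanSpace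 ℝ (Fin (n + 1))) 1, K z = J ⟨Φ z, hz⟩) (nhds y) → Filter.Eventually (fun z : Metric.closedBall (0 : EuclideanSpace ℝ (Fin (n + 1))) 1 => Φ (z : EuclideanSpace ℝ (Fin (n + 1))) ∈ Metric.closedBall (0 : EuclideanSpace ℝ (Fin (n + 1))) 1) (nhds y) → Manifold.IsImmersionAt (𝓡∂ (n + 1)) (𝓡 m) ∞ K y := by
  intro n m N _ _ _ J K Φ hΦ hΦ' y hy hΦy h hK hmaps
  exact isImmersionAt_closedBall_of_eventuallyEq_comp Φ hΦ hΦ' hy hΦy h hK hmaps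

end Summit.SmoothPoincare4.SmoothPoincare4.Theorems.AcyclicBisectionExists.ModpBraidOrbits

end
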